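import Summits.HodgeConjecture.HodgeConjecture.Theses.PadicSemiregularLift
import Literature.AlgebraicGeometry.Motives.HodgeSheaves
import Literature.AlgebraicGeometry.Motives.SupersingularAbelianVariety
import Literature.AlgebraicGeometry.HodgeTheory.AtiyahClassTraceReal

/-!
# Typed transcription of the informal crux `SemiregularSeedsOnAnchors` (stmt-HodgeConjecture-13941)

The route item `PadicSemiregularLift.SemiregularSeedsOnAnchors` (rank 3) is INFORMAL (`signature: null`;
`Theses/PadicSemiregularLift.lean` carries it only as a comment), so no line skeleton can conclude it by
name. This work-file gives a TYPED TRANSCRIPTION over existing declarations, written by the crux-plan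
planner of line `isogeny-untwist-superspecial` (2026-08-16) and meant to be SHARED by every line of this
crux: skeletons import this file and are audited with
`ledger skeleton check Lines/<slug>.lean --crux stmt-HodgeConjecture-13941
  --crux-decl Summit.HodgeConjecture.HodgeConjecture.Cruxes.SemiregularSeedsOnAnchors.SemiregularSeedsOnAnchorsAt`
(the BUNDLED form at the end of this file; the audit admits no `Prop`-class binders).
Sibling seats: import and reuse; extend by ADDING declarations, do not change the ones below (a skeleton's
`_of` theorem is typed against them).

## Why a predicate and not a closed `Prop` (tree convention, `Motives/CrystallineRealization` header)

Every carrier of the informal text is a value of a HYPOTHESIS STRUCTURE or is not yet constructed: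
crystalline cohomology / Berthelot–Ogus / `ch^cris` (`CrystallineRealization p k`, data `C`), the
Buchweitz–Flenner components `σ_q`, `q ≥ 2` (no `Ω^q`-valued trace on Mathlib's `Ext` yet; `σ₀`, `σ₁` ARE
real since 2026-08-15: `HodgeTheory.sigmaZero/sigmaOne`, `IsZeroOneSemiregular`), and "of Hodge origin"
(needs the comparison of `C.dR` with complex Betti cohomology along `ι : K → ℂ`). A closed
`∀ C, …` statement whose conclusion is real is refutable by exotic values of the structure
(`CrystallineRealization` header; `Cruxes/…/Disproof.lean` §A proves the same for σ-as-data: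
`not_isSemiregular_killTrace`, `isSemiregular_tautological`). Hence, exactly as the tree prescribes for this
route ("`def … (C : CrystallineRealization p k) (…semiregularity data…) : Prop`"), the crux is typed as a
PREDICATE of three explicit parameters whose intended values are the classical ones:
* `C : CrystallineRealization p k` — classical crystalline cohomology with its de Rham comparison;
* `Θ : HigherSigma k` — the components `σ_q = tr(At^q ∘ −)/q!`, `2 ≤ q` (degrees `0, 1` are pinned to the
  REAL maps `sigmaZero`, `sigmaOne`, so `Θ := 0` gives `{0,1}`-semiregularity, the strongest notion, and no
  value of `Θ` can make a seed statement easier than the HC-shadow "bundles with Hodge `ch` span `α`");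
* `HO : ∀ 𝒳 i, H^i_dR(X_K/K) → Prop` — "of Hodge origin": `α ⊗_{K,ι} 1` is the de Rham component of a rational
  `(r,r)`-class on `X_K ⊗_ι ℂ` for some `ι : K → ℂ` (load-bearing: with `HO := ⊤` the statement is false,
  CRUX-ATTACK-g2 §3 / `Disproof.withoutHodgeOrigin_count`).
Provers consume `(h : SemiregularSeedsOnAnchors C Θ HO)`; lines prove `… → SemiregularSeedsOnAnchors C Θ HO`
for all `C Θ HO` from stub statements over the same parameters.

## Reading of the informal text, clause by clause (item stmt-HodgeConjecture-13941, `informal`)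

* p-ADIC ANCHOR of dimension `n` (`IsPadicAnchor C n 𝒳`): `k` algebraically closed of characteristic `p`
  (the text has `k = 𝔽̄_p`; any algebraically closed `k` is allowed here — weaker hypothesis, same content),
  `W = W(k)`, `K = W[1/p] = K(p, k)`, `𝒳/W` a smooth proper model of relative dimension `n`
  (`WittScheme.IsSmoothProperModel n 𝒳`: both fibres smooth projective geometrically integral) that is
  projective over `W` (`Crystalline.IsProjectiveOverRing`), `n + 6 < p`, (i) `X_k` COHOMOLOGICALLY
  SUPERSINGULAR: `C.algebraicClasses X_k r = ⊤` for every `r`, (ii) `H^b(𝒳, Ω^a_{𝒳/W})` `p`-torsion-free for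
  all `a, b` (`Motives.hodgeCohomology 𝒳 a b`, the real Hodge cohomology of the `W`-scheme `𝒳`).
* `Lef^r(X_K)` = `C.dR.lefschetzClasses (genericFibre 𝒳) r` (K-span of `r`-fold products of divisor classes).
* p-ADICALLY SEMIREGULAR (`IsPadicSemiregular Θ p X hE`): `⊕_{0 ≤ q < p} σ_q` injective on `Ext²(E,E)`
  (Mathlib `Ext` in `X.Modules`), `σ₀, σ₁` the tree's real maps, `σ_q` (`2 ≤ q < p`) from `Θ`.
* CLAIM (`SemiregularSeedsOnAnchors C Θ HO`): for every anchor, `r`, and `α ∈ F^r H^{2r}_dR(X_K/K)`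
  (`C.dR.fil (2r) r`) that is (a) φ-Tate ON THE NOSE — `α = bo x` with `x ∈ C.tateClasses X_k r`
  (`φ x = p^r x`, a `ℚ_p`-condition) — and (b) of Hodge origin (`HO α`): finitely many finite locally free,
  p-adically semiregular `E_i` on `X_k` with the BEK Hodge condition in ALL degrees (`C.HodgeCondition 𝒳 E_i`)
  such that `α ∈ K-span{bo ch_r^cris(E_i)} + Lef^r(X_K)` (`SeedSpan C Θ 𝒳 r α`).
* NOT transcribed: the COHERENT-SEED VARIANT (the real `σ₀, σ₁` need `IsFiniteLocallyFree`); the REMARKS.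
-/

set_option linter.dupNamespace false

noncomputable section

open CategoryTheory CategoryTheory.Abelian AlgebraicGeometry Opposite
open scoped Isocrystal
open Literature.AlgebraicGeometry.Motives Literature.AlgebraicGeometry.Motives.WittScheme
open Literature.AlgebraicGeometry.HodgeTheory

universe u

namespace Summit.HodgeConjecture.HodgeConjecture.Cruxes.SemiregularSeedsOnAnchors

/-! ## p-adic semiregularity on real carriers (degrees 0, 1 real; degrees ≥ 2 as data) -/

/-- The HIGHER components of the crystalline Buchweitz–Flenner semiregularity map, as data: for every
`k`-scheme `X`, finite locally free `E` and `q` (meant: `2 ≤ q`), an additive map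
`σ_q : Ext²_{𝒪_X}(E, E) → H^{q+2}(X, Ω^q_{X/k})` on the tree's real groups (intended value:
`σ_q(ξ) = (−1)^q tr(ξ ∘ At(E)^q)/q!`, Buchweitz–Flenner 2003 Def. 4.1; not constructible at this pin: no
`Ω^q`-valued trace on `Ext`). Degrees `0` and `1` are NOT data: see `IsPadicSemiregular`. -/
structure HigherSigma (k : Type u) [Field k] where
  /-- `σ_q` on `Ext²(E, E)`, `q ≥ 2` intended. -/
  sigma : ∀ (X : SchemeOver k) (E : X.left.Modules), IsFiniteLocallyFree E → ∀ q : ℕ,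
    Ext.{u + 1} E E 2 →+ hodgeCohomology X q (q + 2)

/-- The zero package: with it `IsPadicSemiregular` is the tree's real `{0,1}`-semiregularity. -/
instance (k : Type u) [Field k] : Zero (HigherSigma k) := ⟨⟨fun _ _ _ _ => 0⟩⟩

variable {k : Type u} [Field k]

/-- `E` (finite locally free on the `k`-scheme `X`) is **p-adically semiregular**: the joint kernel of the
REAL components `σ₀ = Tr : Ext²(E,E) → H²(X, 𝒪)` (`sigmaZero`), `σ₁ = Tr(At ∘ −) : Ext²(E,E) → H³(X, Ω¹)`
(`sigmaOne`) and the higher components `σ_q`, `2 ≤ q < p`, of `Θ` is zero — i.e. `⊕_{q<p} σ_q` is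
injective (the crux's notion verbatim; Buchweitz–Flenner 2003 Def. 4.1, §5 "I-semiregular"). -/
def IsPadicSemiregular (Θ : HigherSigma k) (p : ℕ) (X : SchemeOver k) {E : X.left.Modules}
    (hE : IsFiniteLocallyFree E) : Prop :=
  ∀ x : Ext.{u + 1} E E 2, sigmaZero hE x = 0 → sigmaOne hE x = 0 →
    (∀ q : ℕ, 2 ≤ q → q < p → Θ.sigma X E hE q x = 0) → x = 0

/-- `{0,1}`-semiregular (real carriers) ⇒ p-adically semiregular for every `Θ` and `p`. -/
theorem isPadicSemiregular_of_isZeroOneSemiregular (Θ : HigherSigma k) (p : ℕ) (X : SchemeOver k)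
    {E : X.left.Modules} (hE : IsFiniteLocallyFree E) (h : IsZeroOneSemiregular.{u + 1} hE) :
    IsPadicSemiregular Θ p X hE := by
  intro x h0 h1 _
  exact (isZeroOneSemiregular_iff hE).1 h x h0 h1

/-- With the zero package, p-adic semiregularity IS `{0,1}`-semiregularity. -/
theorem isPadicSemiregular_zero_iff (p : ℕ) (X : SchemeOver k) {E : X.left.Modules}
    (hE : IsFiniteLocallyFree E) :
    IsPadicSemiregular (0 : HigherSigma k) p X hE ↔ IsZeroOneSemiregular.{u + 1} hE := by
  rw [isZeroOneSemiregular_iff]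
  constructor
  · intro h x h0 h1
    exact h x h0 h1 fun _ _ _ => rfl
  · intro h x h0 h1 _
    exact h x h0 h1

/-! ## Anchors, seed spans, the crux -/

variable {p : ℕ} [Fact p.Prime] [CharP k p] [PerfectRing k p]

/-- **p-adic anchor of dimension `n`** (the crux's DEFINITIONS paragraph): `𝒳/W(k)` a smooth proper
model of relative dimension `n`, projective over `W`, `n + 6 < p`, with cohomologically supersingular
special fibre (every crystalline class is algebraic: `ρ_r = b_{2r}`) and `p`-torsion-free Hodge cohomology
`H^b(𝒳, Ω^a_{𝒳/W})` for all `a, b`. -/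
structure IsPadicAnchor (C : CrystallineRealization p k) (n : ℕ) (𝒳 : SchemeOver (WittVector p k)) :
    Prop where
  /-- smooth proper model, both fibres smooth projective geometrically integral of dimension `n` -/
  model : IsSmoothProperModel n 𝒳
  /-- projective over `W` -/
  projective : Literature.AlgebraicGeometry.Crystalline.IsProjectiveOverRing 𝒳
  /-- `n + 6 < p` -/
  dim_lt : n + 6 < p
  /-- (i) cohomologically supersingular special fibre -/
  supersingular : ∀ r : ℕ, C.algebraicClasses (specialFibre 𝒳) r = ⊤
  /-- (ii) torsion-free Hodge cohomology of `𝒳/W` -/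
  torsionFree : ∀ (a b : ℕ) (x : hodgeCohomology 𝒳 a b), (p : ℤ) • x = 0 → x = 0

/-- The crux's CONCLUSION for one `(𝒳, r, α)`: finitely many finite locally free, p-adically semiregular
`E_i` on `X_k` with the Bloch–Esnault–Kerz Hodge condition in all degrees such that
`α ∈ K-span{bo ch_r^cris(E_i)} + Lef^r(X_K)`. -/
def SeedSpan (C : CrystallineRealization p k) (Θ : HigherSigma k) (𝒳 : SchemeOver (WittVector p k))
    (r : ℕ) (α : C.dR.obj (genericFibre 𝒳) (2 * r)) : Prop :=
  ∃ (m : ℕ) (E : Fin m → (specialFibre 𝒳).left.Modules) (hE : ∀ i, IsFiniteLocallyFree (E i)),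
    (∀ i, IsPadicSemiregular Θ p (specialFibre 𝒳) (hE i) ∧ C.HodgeCondition 𝒳 (E i)) ∧
    α ∈ Submodule.span K(p, k)
        (Set.range fun i => C.bo 𝒳 (2 * r) (C.chCris (specialFibre 𝒳) (E i) r)) ⊔
      C.dR.lefschetzClasses (genericFibre 𝒳) r

/-- **`SemiregularSeedsOnAnchors`, typed** (predicate on the classical data `C`, `Θ`, `HO`; see the module
docstring). For every algebraically-closed-residue-field p-adic anchor `(𝒳/W(k), n)`, every `r` and every
`α ∈ F^r H^{2r}_dR(X_K/K)` that is (a) φ-Tate on the nose (`α = bo x`, `φ x = p^r x`) and (b) of Hodge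
origin (`HO α`), the seed span holds. -/
def SemiregularSeedsOnAnchors [IsAlgClosed k] (C : CrystallineRealization p k) (Θ : HigherSigma k)
    (HO : ∀ ⦃𝒳 : SchemeOver (WittVector p k)⦄ ⦃i : ℕ⦄, C.dR.obj (genericFibre 𝒳) i → Prop) : Prop :=
  ∀ (n : ℕ) (𝒳 : SchemeOver (WittVector p k)), IsPadicAnchor C n 𝒳 →
    ∀ (r : ℕ) (α : C.dR.obj (genericFibre 𝒳) (2 * r)),
      α ∈ C.dR.fil (2 * r) r →
      (∃ x ∈ C.tateClasses (specialFibre 𝒳) r, C.bo 𝒳 (2 * r) x = α) →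
      HO α →
      SeedSpan C Θ 𝒳 r α


/-! ## Bundled form for skeleton audits

`#h21_check_skeleton` admits DATA binders but no `Prop`-class hypotheses (`Fact p.Prime`, `CharP k p`, `PerfectRing k p`,
`IsAlgClosed k` are `Prop`s), and requires the conclusion to apply the crux decl to the theorem's own binders. Lines
therefore conclude the BUNDLED form `SemiregularSeedsOnAnchorsAt F C Θ HO` — definitionally the predicate above, with the
ground-field data and its instances packed into one data binder `F : AnchorField`. -/

/-- Ground-field data of an anchor: a prime `p` and an algebraically closed (perfect) field `k` of characteristic `p`,
with the instances as fields (registered below), so that `CrystallineRealization F.p F.k` elaborates. -/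
structure AnchorField : Type (u + 1) where
  /-- the residue characteristic -/
  p : ℕ
  [fact : Fact p.Prime]
  /-- the residue field (intended `𝔽̄_p`; any algebraically closed field of characteristic `p`) -/
  k : Type u
  [field : Field k]
  [charP : CharP k p]
  [perfect : PerfectRing k p]
  [algClosed : IsAlgClosed k]

attribute [instance] AnchorField.fact AnchorField.field AnchorField.charP AnchorField.perfect
  AnchorField.algClosed

/-- **`SemiregularSeedsOnAnchors`, bundled**: the same predicate with `(p, k, instances)` packed in `F`. This is the
decl a line skeleton concludes (`--crux-decl …Cruxes.SemiregularSeedsOnAnchors.SemiregularSeedsOnAnchorsAt`);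
`semiregularSeedsOnAnchorsAt_iff` records that it IS the predicate. -/
def SemiregularSeedsOnAnchorsAt (F : AnchorField.{u}) (C : CrystallineRealization F.p F.k) (Θ : HigherSigma F.k)
    (HO : ∀ ⦃𝒳 : SchemeOver (WittVector F.p F.k)⦄ ⦃i : ℕ⦄, C.dR.obj (genericFibre 𝒳) i → Prop) : Prop :=
  SemiregularSeedsOnAnchors C Θ HO

theorem semiregularSeedsOnAnchorsAt_iff (F : AnchorField.{u}) (C : CrystallineRealization F.p F.k)
    (Θ : HigherSigma F.k)
    (HO : ∀ ⦃𝒳 : SchemeOver (WittVector F.p F.k)⦄ ⦃i : ℕ⦄, C.dR.obj (genericFibre 𝒳) i → Prop) :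
    SemiregularSeedsOnAnchorsAt F C Θ HO ↔ SemiregularSeedsOnAnchors C Θ HO :=
  Iff.rfl

/-- The unbundled predicate at given `(p, k)` is the bundled one at `⟨p, k⟩`. -/
theorem semiregularSeedsOnAnchors_iff_at [IsAlgClosed k] (C : CrystallineRealization p k) (Θ : HigherSigma k)
    (HO : ∀ ⦃𝒳 : SchemeOver (WittVector p k)⦄ ⦃i : ℕ⦄, C.dR.obj (genericFibre 𝒳) i → Prop) :
    SemiregularSeedsOnAnchors C Θ HO ↔ SemiregularSeedsOnAnchorsAt (AnchorField.mk p k) C Θ HO :=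
  Iff.rfl

end Summit.HodgeConjecture.HodgeConjecture.Cruxes.SemiregularSeedsOnAnchors

end
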